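/-
Copyright: derived here (Resolution Observatory cell `pub-rosobs`, carver gen 57). AI-written Lean; AI review is weaker than expert
review.  Two kernel pieces of engine 1's THEOREM LT / THEOREM R (THEOREM-LT-eng1-g38 §2 Statement B and §4 arithmetic; carver
targets T58-B, T60) for the cell's POLYNOMIAL weighted-centre model `W(f)`.  Instrument — NOT a resolution theorem
and NOT a statement about the invariant of [AbramovichTemkinWlodarczyk2024].
-/
import Mathlib.LinearAlgebra.Matrix.ToLin
import Mathlib.LinearAlgebra.Basis.VectorSpace
import Mathlib.Tactic.Linarith
import Mathlib.Tactic.NormNum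
import Mathlib.Tactic.Positivity
import Mathlib.Tactic.Ring
import Mathlib.Tactic.FieldSimp
import HarnessLib

/-!
# LT kit: the left-inverse transport of LEMMA LL (Statement B) and the arithmetic of THEOREM R

Uniform value line: INSTRUMENT — kernel-checked elementary pieces of engine 1's THEOREM LT / THEOREM R (THEOREM-LT-eng1-g38) in
the cell's polynomial weighted-centre model `W(f)`; NOT a resolution theorem, NOT a statement about the Abramovich–Temkin–Włodarczyk
invariant, NOT summit progress, and NOT a proof of LEMMA K, of the identity `(ID_h)` (LEMMA LL Statement A), of THEOREM LT or of
THEOREM R; AI-written Lean, AI review is weaker than expert review.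

## Content (notes ↔ this file)

* §3 (a) of the notes ("a class of weight `u < w_min + ρ` is `D`-constant for free") is ALREADY in the tree:
  `WeightedBlowup.isWeightedHomogeneous_eq_zero_of_weight_lt` (`WeightedCentreSecondClassGap`), applied to `φ := D εᵤ`,
  `κ := u − ρ > 0`, `κ < w_min ≤ w i`; nothing is re-proved here.
* §2 Statement B ("apply `λ ⊗ id`, constants commute with `D`"): `exists_leftInv_of_mulVec_injective` (an injective constant matrix
  `Κ` over a field has a constant left inverse `λ`, `λ Κ = 1`) and `apply_eq_map_of_leftInv` (if `Σ_f Κ_{h f} • T_f = D(ℛ_h)` for every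
  `h` and `λ Κ = 1` then `T_f = D(Σ_h λ_{f h} • ℛ_h)` for every `f`, for ANY `K`-linear `D` on any `K`-module) — so `m_f := Σ_h λ_{f h} • ℛ_h`
  (the notes' `−(λ ⊗ id)ℛ` with the sign folded into `ℛ`).
* §4 arithmetic of THEOREM R: `e_eq_one` (`p^e ρ ≤ 1/2` and `ρ > 1/(p(p+1))`, `p ≥ 2`, force `e = 1`), `rho_le_of_pure_weight`
  (`pρ ≤ 1/2 ⇒ ρ ≤ 1/(2p)`), `inv_lt_of_class_weight` (`u ≥ (p+1)ρ > 1/p`), `class_weight_chain` (`u ≥ pρ + ρ ⇒ u > pρ > ρ`).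

NOT here: LEMMA K (its char-`p` input is ALREADY in the tree: `WeightedBlowup.notMem_vars_of_pderiv_eq_zero`,
`WeightedCentreLayerEquation` §6), the identity `(ID_h)`, the coordinate change `(Tr)` as an automorphism, the induction of §3 (b).

References: [Lang2002] Ch. XIII (matrices and linear maps; left inverses of injective linear maps over a field), Ch. IV §1;
context [AbramovichTemkinWlodarczyk2024] §5 (weights of a weighted centre).
-/

namespace Literature.AlgebraicGeometry.Resolution.WeightedBlowup

namespace LTKit

/-! ## §2 Statement B: the left-inverse transport -/

section LeftInverse

variable {K : Type*} [Field K] {ι κ : Type*} [Fintype ι] [Fintype κ] [DecidableEq ι] [DecidableEq κ]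

/-- An injective constant matrix over a field has a constant left inverse (`λ` of the notes, for the injective pin map `Κ` of LEMMA K).
[cite: Lang2002, Ch. XIII] -/
theorem exists_leftInv_of_mulVec_injective (A : Matrix κ ι K) (hA : Function.Injective A.mulVec) :
    ∃ B : Matrix ι κ K, B * A = 1 := by
  have hker : LinearMap.ker (Matrix.toLin' A) = ⊥ := by
    rw [LinearMap.ker_eq_bot, Matrix.toLin'_apply']
    exact hA
  obtain ⟨g, hg⟩ := LinearMap.exists_leftInverse_of_injective (Matrix.toLin' A) hker
  refine ⟨LinearMap.toMatrix' g, ?_⟩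
  have h := congrArg LinearMap.toMatrix' hg
  rwa [LinearMap.toMatrix'_comp, LinearMap.toMatrix'_toLin', LinearMap.toMatrix'_id] at h

variable {S : Type*} [AddCommMonoid S] [Module K S]

omit [DecidableEq κ] in
/-- **LEMMA LL, Statement B** (THEOREM-LT §2): if `Σ_f Κ_{h f} • T_f = D(ℛ_h)` for every `h` (the identity `(ID_h)`, sign folded into
`ℛ`) and `λ Κ = 1` with CONSTANT `λ`, then `T_f = D(m_f)` with `m_f := Σ_h λ_{f h} • ℛ_h` — for any `K`-linear `D` on any `K`-module
(coefficientwise: "`λ ⊗ id` commutes with `id ⊗ D`"). [cite: Lang2002, Ch. XIII] -/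
theorem apply_eq_map_of_leftInv (D : S →ₗ[K] S) (A : Matrix κ ι K) (B : Matrix ι κ K) (hBA : B * A = 1) (T : ι → S)
    (Rv : κ → S) (h : ∀ a : κ, ∑ f, A a f • T f = D (Rv a)) (f : ι) : T f = D (∑ a, B f a • Rv a) := by
  have key : ∑ a, B f a • (∑ f', A a f' • T f') = T f := by
    calc ∑ a, B f a • (∑ f', A a f' • T f') = ∑ a, ∑ f', (B f a * A a f') • T f' := by
          simp_rw [Finset.smul_sum, smul_smul]
      _ = ∑ f', ∑ a, (B f a * A a f') • T f' := Finset.sum_comm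
      _ = ∑ f', (B * A) f f' • T f' := by simp_rw [Matrix.mul_apply, Finset.sum_smul]
      _ = T f := by
          rw [hBA]
          simp_rw [Matrix.one_apply, ite_smul, one_smul, zero_smul]
          rw [Finset.sum_ite_eq]
          simp
  rw [← key]
  simp_rw [h]
  rw [map_sum]
  simp_rw [map_smul]

/-- The two steps combined: an injective constant `Κ` and the identities `(ID_h)` give `m` with `T_f = D(m_f)` for all `f`.
[cite: Lang2002, Ch. XIII] -/
theorem exists_apply_eq_map (D : S →ₗ[K] S) (A : Matrix κ ι K) (hA : Function.Injective A.mulVec) (T : ι → S) (Rv : κ → S)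
    (h : ∀ a : κ, ∑ f, A a f • T f = D (Rv a)) : ∃ m : ι → S, ∀ f, T f = D (m f) := by
  obtain ⟨B, hBA⟩ := exists_leftInv_of_mulVec_injective A hA
  exact ⟨fun f => ∑ a, B f a • Rv a, apply_eq_map_of_leftInv D A B hBA T Rv h⟩

end LeftInverse

/-! ## §4: the arithmetic of THEOREM R -/

/-- `e = 1`: `p^e ρ ≤ 1/2` (`w* = p^e ρ ≤ 1/2`) and `ρ > 1/(p(p+1))` with `p ≥ 2` leave only `e = 1`
(`p²ρ > p/(p+1) ≥ 2/3 > 1/2`) (THEOREM-LT §4). [cite: AbramovichTemkinWlodarczyk2024, §5] -/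
theorem e_eq_one {p e : ℕ} (hp : 2 ≤ p) (he : 1 ≤ e) {ρ : ℚ} (hρ : 1 / ((p : ℚ) * (p + 1)) < ρ)
    (hw : (p : ℚ) ^ e * ρ ≤ 1/2) : e = 1 := by
  by_contra hne
  have he2 : 2 ≤ e := by omega
  have hp2 : (2 : ℚ) ≤ p := by exact_mod_cast hp
  have hp0 : (0 : ℚ) < p := by linarith
  have hρ0 : 0 < ρ := lt_trans (by positivity) hρ
  have hpow : (p : ℚ) ^ 2 ≤ (p : ℚ) ^ e := pow_le_pow_right₀ (by linarith) he2
  rw [div_lt_iff₀ (by positivity)] at hρ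
  nlinarith [mul_le_mul_of_nonneg_right hpow hρ0.le, mul_nonneg hp0.le hρ0.le, mul_nonneg (sub_nonneg.mpr hp2) (mul_nonneg hp0.le hρ0.le)]

/-- No system at all if `ρ > 1/(2p)`: the pure weight `w* = pρ` is `≤ 1/2` (THEOREM-LT §4). [cite: AbramovichTemkinWlodarczyk2024, §5] -/
theorem rho_le_of_pure_weight {p ρ : ℚ} (hp : 0 < p) (hw : p * ρ ≤ 1/2) : ρ ≤ 1 / (2 * p) := by
  rw [le_div_iff₀ (by positivity)]
  linarith

/-- Every class of weight `u ≥ (p+1)ρ` has `u > 1/p` when `ρ > 1/(p(p+1))` (THEOREM-LT §4, the hypothesis "`u > 1/p`" of THEOREM LT).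
[cite: AbramovichTemkinWlodarczyk2024, §5] -/
theorem inv_lt_of_class_weight {p : ℚ} (hp : 0 < p) {ρ u : ℚ} (hρ : 1 / (p * (p + 1)) < ρ) (hu : (p + 1) * ρ ≤ u) :
    1 / p < u := by
  rw [div_lt_iff₀ (by positivity)] at hρ
  rw [div_lt_iff₀ hp]
  nlinarith [mul_le_mul_of_nonneg_right hu hp.le]

/-- The chain `u ≥ w_min + ρ ≥ pρ + ρ ⇒ u ≥ (p+1)ρ`, `u > pρ > ρ` (`p > 1`, `ρ > 0`) (THEOREM-LT §4, feeding "`u > η`").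
[cite: AbramovichTemkinWlodarczyk2024, §5] -/
theorem class_weight_chain {p ρ wmin u : ℚ} (hp : 1 < p) (hρ : 0 < ρ) (hR0 : p * ρ ≤ wmin) (hu : wmin + ρ ≤ u) :
    (p + 1) * ρ ≤ u ∧ p * ρ < u ∧ ρ < p * ρ := by
  refine ⟨by linarith, by linarith, by nlinarith⟩

end LTKit

end Literature.AlgebraicGeometry.Resolution.WeightedBlowup
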